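import Summits.NavierStokesRegularity.FluidComputer.GateBudgetLadderBalance
import Summits.NavierStokesRegularity.FluidComputer.GateBudgetDudHorizonSharp
import HarnessLib

/-!
# GateBudget part 95 — the pair-limited dud horizon: the misfire ladder at every winding (§269)

Cell `pub-fluidc`, blueprint seat bp1 (gen 37 close-out, SPEC-INPUT-bp1 §BS(3), the read-out of
part 94 §268 on the lattice); namespace `Summit.NavierStokesRegularity.FluidComputer.GateBudget`,
headline member `RotorKnob.rotorCircuit K K¹⁰ ε ρ` of the two-scale family from `delayInit`
(5.6), `K ≥ 16`, on the lattice window `200ε/K²⁰ ≤ ρ² ≤ 2ε/K¹⁰`, `ε² ≤ 1/(6K²⁰)`, `ε = kK¹⁰ρ²`;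
modes `0 = a` (carrier), `1 = b` (clock), `2 = c` (trigger), `3 = d` (transfer), `4 = ã`
(output). HONEST FRAMING: a low prior, high value-of-information experiment on Tao's machine
paradigm; NOT a claim that NS blows up.

WHAT. Part 89 §258 `knob_misfire_ladder_sharp` instantiates part 88's sharp ladder at part 86's
anchor and ledgers (`P₁ = 10⁻⁴`, `D = 7/K⁴`, `S = (1.1 + k²/10)/K⁹`, `L ≤ 42/K⁹`) under TWO
windows: the clock window `(N - 1)L ≤ 0.144` and the pair window `(N - 1)(1.1 + k²/10)/K⁹ ≤
0.0199`; its headline §259 therefore needs `k ≤ 6` and `N - 1 ≤ 3.428·10⁻³K⁹`. §269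
`knob_misfire_ladder_balance` is §258 on part 94 §268's balanced ladder: THE CLOCK WINDOW IS
DROPPED — for every winding `1 ≤ k ≤ K²` and every `N` inside the PAIR window alone, the clean
misfire ladder has its `N` normal-form rungs (`5/4 ≤ θₙ ≤ 29/20`, `P(rₙ) ≤ 10⁻⁴ + (n - 1)S ≤
1/50`, `(n - 1)/K⁹ ≤ ã(rₙ) ≤ 0.1415`, `|d(rₙ)| ≤ 7/K⁴`); §269 `knob_ladder_no_output_balance`:
no output (`ã ≤ 0.1415`) on `[0, 1.8282 + N]` for every such `N ≥ 1`. NUMBERS: the horizon is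
`N - 1 ≤ 0.0199K⁹/(1.1 + k²/10)` — `0.01658K⁹` at `k = 1` (`×4.8` part 89's `3.428·10⁻³K⁹`,
`×33` part 83's `5.03·10⁻⁴K⁹`), within `8.6×` of part 72's forced ceiling `0.1415K⁹ + 1`, and
it is now limited by the PAIR LEDGER ONLY (part 86's `S`), uniformly in `K ≥ 16`.
HOW. Part 86's anchor (`θ₁ ≥ 1.394 ≥ 1.39 - L`), part 83/86's numerics `two_sided_numerics`,
`clock_slip_numerics`, part 89's `sharp_loss_numerics` (`L ≤ 42/K⁹`), `N - 1 ≤ K⁹` from the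
pair window, then part 94 §268 `knob_ladder_balance`; the no-output corollary by the output's
monotonicity (part 9) from the last rung.
HONEST LIMITS. (i) the pair ledger `S = (1.1 + k²/10)/K⁹` per rung is part 86's crude
two-sided slip (the true pair drift per rung is `O(k/K¹⁰ + log K/K¹⁰)`-ish); closing the
remaining factor `8.6` to part 72's ceiling is a PAIR-side task, not a clock-side one; (ii)
existence of the rungs, no uniqueness; (iii) the lattice `ε = kK¹⁰ρ²`, `k ≤ K²`; (iv) nothing
about Navier–Stokes.
[cite: Tao2016AveragedNS, §5.5 Theorem 5.3, (5.5), (5.6), (b-eq), (c-eq), (d-eq), (ta-eq),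
(energy-con), (est)]
-/

noncomputable section

namespace Summit.NavierStokesRegularity.FluidComputer.GateBudget

open Real Set Filter Topology
open Literature.Analysis.FluidPDE.Tao2016AveragedNS

variable {K ε ρ : ℝ} {X : ℝ → Fin 5 → ℝ} {C : ℝ → ℝ}

/-! ## §269 The misfire ladder inside the pair window alone -/

/-- §269 THE PAIR WINDOW IMPLIES `N - 1 ≤ K⁹` (`K ≥ 16`): from `(N - 1)(1.1 + k²/10)/K⁹ ≤
0.0199`. [folklore] -/
theorem pair_window_coarse (hK : 16 ≤ K) {k y : ℝ}
    (hy : y * ((11 / 10 + k ^ 2 / 10) / K ^ 9) ≤ 199 / 10000) : y ≤ K ^ 9 := by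
  have hK0 : (0 : ℝ) < K := by linarith
  have hK9 : (0 : ℝ) < K ^ 9 := by positivity
  by_cases hy0 : 0 ≤ y
  · have h1 : (1 : ℝ) / K ^ 9 ≤ (11 / 10 + k ^ 2 / 10) / K ^ 9 :=
      div_le_div_of_nonneg_right (by nlinarith only [sq_nonneg k]) hK9.le
    have h2 := mul_le_mul_of_nonneg_left h1 hy0
    have h3 : y * (1 / K ^ 9) ≤ 199 / 10000 := h2.trans hy
    rw [mul_one_div, div_le_iff₀ hK9] at h3
    nlinarith only [h3, hK9]
  · linarith only [not_le.1 hy0, hK9]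

/-- §269 **THE MISFIRE LADDER AT EVERY WINDING** (headline member from `delayInit` with a trigger
primitive, `K ≥ 16`, `0 < ε`, `ε² ≤ 1/(6K²⁰)`, `0 < ρ`, `200ε/K²⁰ ≤ ρ²`, `K¹⁰ρ² ≤ 2ε`, `ε =
kK¹⁰ρ²`, `k ≤ K²`): for every `N` in the PAIR window `(N - 1)(1.1 + k²/10)/K⁹ ≤ 0.0199` — and
NO clock window — and every `1 ≤ n ≤ N` there is a normal-form ignition `rₙ > 1.8282 + n` with
`5/4 ≤ θₙ ≤ 29/20`, `P(rₙ) ≤ 10⁻⁴ + (n - 1)(1.1 + k²/10)/K⁹ ≤ 1/50`, `(n - 1)/K⁹ ≤ ã(rₙ) ≤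
0.1415`, `|d(rₙ)| ≤ 7/K⁴`. [derived: part 94 §268, part 86 §251–§252, part 89 §258] -/
theorem knob_misfire_ladder_balance
    (hX : ∀ t, HasDerivAt X (RotorKnob.rotorCircuit K (K ^ 10) ε ρ (X t)) t)
    (h0 : X 0 = delayInit) (hC : ∀ t, HasDerivAt C (X t 2) t) (hK : 16 ≤ K)
    (hε : 0 < ε) (hεK : ε ^ 2 ≤ 1 / (6 * K ^ 20)) (hρ : 0 < ρ)
    (hlo : 200 * ε / K ^ 20 ≤ ρ ^ 2) (hhi : K ^ 10 * ρ ^ 2 ≤ 2 * ε) (k : ℕ)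
    (hk : ε = k * K ^ 10 * ρ ^ 2) (hkK : (k : ℝ) ≤ K ^ 2) (N : ℕ)
    (hNP : ((N : ℝ) - 1) * ((11 / 10 + k ^ 2 / 10) / K ^ 9) ≤ 199 / 10000) :
    ∀ n : ℕ, 1 ≤ n → n ≤ N → ∃ r θ : ℝ, 18282 / 10000 + n < r ∧ X r 1 = θ * ε ∧
      5 / 4 ≤ θ ∧ θ ≤ 29 / 20 ∧ X r 2 = ρ ^ 2 / K ^ 9 ∧
      X r 3 ^ 2 + X r 4 ^ 2 ≤ 1 / 10000 + ((n : ℝ) - 1) * ((11 / 10 + k ^ 2 / 10) / K ^ 9) ∧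
      X r 3 ^ 2 + X r 4 ^ 2 ≤ 1 / 50 ∧
      ((n : ℝ) - 1) / K ^ 9 ≤ X r 4 ∧ X r 4 ≤ 1415 / 10000 ∧ |X r 3| ≤ 7 / K ^ 4 := by
  obtain ⟨r₁, θ₁, hr1, hb1, hθlo, hθhi, hc1, he0, hP1, hd1, hk1⟩ :=
    knob_ladder_anchor_member hX h0 hC hK hε hεK hρ hlo hhi k hk
  obtain ⟨hD, hU, -, hD0sq, hres⟩ := two_sided_numerics hK hk1 hkK
  have hS := clock_slip_numerics hK hk1 hkK
  obtain ⟨hL0, hL42⟩ := sharp_loss_numerics hK hk1 hkK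
  have hN9 : (N : ℝ) - 1 ≤ K ^ 9 := pair_window_coarse hK hNP
  have hθ₀lo : 139 / 100 - (242 * log K / K ^ 10
        + 37 * (7 / K ^ 4 + (2 * k + 3) / (5 * K ^ 9) + 4 / K ^ 9) / K ^ 9) ≤ θ₁ := by
    linarith only [hL0, hθlo]
  have hNP' : (k * π / (49 / 100 * K ^ 10 - 1) + 2 / K ^ 10 + 245 / K ^ 8) ^ 2
      + (3 * (k * π / ((25 / 16 - 1 / 10 ^ 6) * K ^ 10 - 1) + 1 / K ^ 19
        + 310 * log K / K ^ 9) / 10 + 6 / K ^ 9)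
      + ((N : ℝ) - 1) * ((11 / 10 + k ^ 2 / 10) / K ^ 9) ≤ 1 / 50 := by
    linarith only [hres, hNP]
  intro n hn hnN
  obtain ⟨r, θ, hr, hb, hθ1, hθ2, hc, hP, hP50, hA, ha, hd⟩ := knob_ladder_balance hX h0 hC hK
    hε hεK hρ hlo hhi k hk (le_of_lt (by linarith only [hr1])) hb1 hc1 hP1 hθ₀lo
    (by linarith only [hθhi]) hL42 hN9 le_rfl he0 hd1 hD hU hS le_rfl hNP' n hn hnN
  refine ⟨r, θ, by linarith only [hr, hr1], hb, hθ1, hθ2, hc, by linarith only [hP, hD0sq],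
    hP50, by simpa using hA, ha, hd⟩

/-- §269 **NO OUTPUT INSIDE THE PAIR WINDOW** (headline member, `K ≥ 16`, lattice `ε = kK¹⁰ρ²`
with `k ≤ K²`, any `N ≥ 1` with `(N - 1)(1.1 + k²/10)/K⁹ ≤ 0.0199`): `ã(t) ≤ 0.1415` for all
`t ∈ [0, 1.8282 + N]` — the machine misfires cleanly, rung after rung, for a time
`≳ 0.0199K⁹/(1.1 + k²/10)`, and never delivers. [derived: this file §269, part 9] -/
theorem knob_ladder_no_output_balance
    (hX : ∀ t, HasDerivAt X (RotorKnob.rotorCircuit K (K ^ 10) ε ρ (X t)) t)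
    (h0 : X 0 = delayInit) (hC : ∀ t, HasDerivAt C (X t 2) t) (hK : 16 ≤ K)
    (hε : 0 < ε) (hεK : ε ^ 2 ≤ 1 / (6 * K ^ 20)) (hρ : 0 < ρ)
    (hlo : 200 * ε / K ^ 20 ≤ ρ ^ 2) (hhi : K ^ 10 * ρ ^ 2 ≤ 2 * ε) (k : ℕ)
    (hk : ε = k * K ^ 10 * ρ ^ 2) (hkK : (k : ℝ) ≤ K ^ 2) (N : ℕ) (hN1 : 1 ≤ N)
    (hNP : ((N : ℝ) - 1) * ((11 / 10 + k ^ 2 / 10) / K ^ 9) ≤ 199 / 10000) :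
    ∀ t ∈ Icc (0 : ℝ) (18282 / 10000 + N), X t 4 ≤ 1415 / 10000 := by
  have hK0 : (0 : ℝ) < K := by linarith
  obtain ⟨r, θ, hr, -, -, -, -, -, -, -, ha, -⟩ :=
    knob_misfire_ladder_balance hX h0 hC hK hε hεK hρ hlo hhi k hk hkK N hNP N hN1 le_rfl
  intro t ht
  exact (RotorKnob.rotorCircuit_output_monotone hK0.le hX (by linarith only [ht.2, hr])).trans ha

end Summit.NavierStokesRegularity.FluidComputer.GateBudget

end
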